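import Summits.BirchSwinnertonDyer.Rank2.SilentClassBSDRank
import HarnessLib

/-!
# The BSD-rank door AT THE ANCHORS THEMSELVES: `E₀ = [1,-1,0,-675,6912]` (`N₀ = 690561`) and `E₁ = [1,-1,0,-21016,-1167149]`
# (`N₁ = 19070689`) have `ord_{s=1} L(E,s) = rank E(ℚ) = 2` modulo PRINT + their two finite 2-adic computations + the now CERTIFIED
# input `L″(E,1) ≠ 0` (cell bsd-rank2, lead star-p1 GEN 25)

`Rank2/SilentClassBSDRank.lean` (p2 GEN 50) reads the silent prime door at the summit predicate for the TWISTS `A ≅ E^{(q)}` of an anchor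
`E`; the anchor itself was left out, although everything needed is in the tree: `anchor_base_of_chi8Floor` (`Rank2/MatsunoBridgeAtTwoSilent.lean`
§5a: from Kato's divisibility at `2`, the χ₈-floor `hS`, two independent points and `μ(X(E/ℚ_∞)) = 0` — the last from the GRH-free
certificate `#(Sel_{2^∞}(E/ℚ_∞)[2])^{Γ₁} ≤ 4` by `SelmerDualData.mu_eq_zero_of_natCard_selmerFixedCert_one_le` — one gets `rank E(ℚ) =
corank_{ℤ₂} Sel_{2^∞}(E/ℚ) = ord_{T=0} L₂(E,T) = 2` and `Ш(E)[2^∞]` finite), `selmerCorank_eq_zero_of_L_ne_zero`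
(`Rank2/MatsunoBridgeAtTwoDichotomy.lean`: `L(E,1) ≠ 0` would force corank `0` — so `L(E,1) = 0`, WITHOUT Gross–Zagier–Kolyvagin), the
2-parity theorem (`w(E) = (−1)^{corank} = +1`), `Even r_an ↔ w = +1` and the analytic-rank window lemmas (`L(E,1) = 0 ⇒ r_an ≥ 1`, even ⇒
`r_an ≥ 2`; `L″(E,1) ≠ 0 ⇒ r_an ≤ 2`).  Hence:

* `anchor_bsdRank_iff` — generic over the anchor: **`r_an(E) = rank E(ℚ)` ⟺ `L″(E,1) ≠ 0` ⟺ `r_an(E) ≤ 2`**, with `L(E,1) = 0`, `r_an` even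
  `≥ 2`, `rank = corank = 2`, `Ш(E)[2^∞]` finite proved outright (modulo the displayed hypotheses);
* `anchor_bsdRank_of_secondDeriv` — implication form keyed on `h2 : L″(E,1) ≠ 0`;
* `bsdRank_690561_of_secondDeriv`, `bsdRank_19070689_of_secondDeriv` — the two anchors, whose `h2` is CERTIFIED by interval arithmetic
  (kit j337494, Arb ball arithmetic on the Buhler–Gross–Zagier series; evidence on stmt-BirchSwinnertonDyer-20341):
  `L″(E₀,1) ∈ [29.9761563, 29.9761573]`, `L″(E₁,1) ∈ [44.2219458, 44.2219508]`.

Displayed hypotheses: PRINT `hmod` (modularity), `hKato` (Kato 2004 Thm. 17.4 at `2`), `hpar` (2-parity; Dokchitser–Dokchitser); the anchor's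
two finite 2-adic computations `hS` (χ₈-floor) and `hcert`; and `h2`.  (Matsuno's Thm. 5.1 `h51` is NOT needed at the anchor.)  The tree has
no certified evaluation of `entireLFunction`, so `h2` stays displayed, exactly like `hS`/`hcert`.

HONEST FRAMING (Barrier B1): two individual curves; per-curve statements are not summit-bearing; everything is CONDITIONAL on the displayed
hypotheses; BSD is NOT proved; no S0 motion (PARTITION D-0054: none — r_an ≥ 2, axis S0).

References: Kato, Astérisque 295 (2004) Thm. 17.4; Greenberg, LNM 1716 (1999) Thm. 1.2, §1; T. & V. Dokchitser, Ann. of Math. 172 (2010)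
Thm. 1.4; Buhler–Gross–Zagier, Math. Comp. 44 (1985); Cremona, *Algorithms for Modular Elliptic Curves* (2nd ed.) §2.13.
-/

set_option autoImplicit false

noncomputable section

open scoped Classical MatrixGroups ModularForm NumberTheorySymbols

open CongruenceSubgroup NumberField IsDedekindDomain Rat.HeightOneSpectrum WeierstrassCurve
  Literature.NumberTheory.EllipticCurves
  Literature.NumberTheory.EllipticCurves.ModularForms
  Literature.NumberTheory.EllipticCurves.IwasawaAlgebra
  Literature.NumberTheory.EllipticCurves.Rank1Residual
  Literature.NumberTheory.EllipticCurves.Rank1Residual.Typed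
  Literature.NumberTheory.EllipticCurves.Greenberg1999
  Literature.NumberTheory.EllipticCurves.Rank1Residual.X11RankOneCertificates
  Summit.BirchSwinnertonDyer.BirchSwinnertonDyer.Theorems.Rank1ResidualX1Defs
  Summit.BirchSwinnertonDyer.BirchSwinnertonDyer.Theorems.TwoAdicTwistConverse
  Summit.BirchSwinnertonDyer.BirchSwinnertonDyer.Rank1Residual.IntModel
  Summit.BirchSwinnertonDyer.Rank1Residual.X1.MuLambda
  Summit.BirchSwinnertonDyer.Rank1Residual.X1.MuPart
  Summit.BirchSwinnertonDyer.Rank1Residual.X1.ParitySqueeze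
  Summit.BirchSwinnertonDyer.Rank1Residual.X1.RankOneParitySqueeze
  Summit.BirchSwinnertonDyer.Rank1Residual.X5
  Summit.BirchSwinnertonDyer.Rank1Residual.X5.O1
  Summit.BirchSwinnertonDyer.Rank1Residual.Supersingular
  Literature.NumberTheory.EllipticCurves.PadicIntSeries

namespace Summit.BirchSwinnertonDyer.Rank2

/-! ### §1. Generic over the anchor -/

section Generic

variable (W₀ : WeierstrassCurve ℚ) [W₀.IsElliptic] [W₀.IsGloballyMinimal] [NeZero (W₀.conductorNorm ℤ)]
  (hord₀ : IsOrdinaryAt W₀ 2) (hmod : exists_isNewformOf)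
  (hKato : ∀ (V : WeierstrassCurve ℚ) [V.IsElliptic] [V.IsGloballyMinimal] [NeZero (V.conductorNorm ℤ)]
    (f : CuspForm (Gamma0 (V.conductorNorm ℤ)) 2), IsNewformOf V f → kato_divisibility_allPrimes V 2 (f := f))
  (hpar : ∀ (V : WeierstrassCurve ℚ) [V.IsElliptic], p_parity V 2)
  (hrank₀ : 2 ≤ W₀.mordellWeilRank)
  (hS₀ : ∀ f₀ : CuspForm (Gamma0 (W₀.conductorNorm ℤ)) 2, IsNewformOf W₀ f₀ → (2 : ℝ)⁻¹ ^ 3 <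
    ‖((ratTwistedSymbolSum f₀ (ZMod.χ₈.ringHomComp (Int.castRingHom ℚ)) : ℚ) : ℚ_[2])‖)
  {κ : ZpExtension ℚ 2} {γ : Field.absoluteGaloisGroup ℚ} (hκ : κ.IsCyclotomic)
  (hγ : κ.IsTopGenerator γ) (hγ' : IsCyclotomicVariable 2 γ)
  [Finite (selmerFixedCert W₀ κ γ 1)] (hcert : Nat.card (selmerFixedCert W₀ κ γ 1) ≤ 4)

include hord₀ hmod hKato hpar hrank₀ hS₀ hκ hγ hγ' hcert

/-- **The anchor's own package**: good ordinary at `2`, two independent points, the χ₈-floor and the layer-1 certificate give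
`L(E,1) = 0`, `w(E) = +1`, `r_an(E)` even and `≥ 2`, `rank E(ℚ) = corank_{ℤ₂} Sel_{2^∞}(E/ℚ) = 2`, `Ш(E)[2^∞]` finite — `L(E,1) = 0` WITHOUT
Gross–Zagier–Kolyvagin (`L(E,1) ≠ 0` would force corank `0` by Kato at `2`).  B1: no value of `r_an`; BSD not proved.
[cite: Kato2004Asterisque, Thm. 17.4 (1)(2) (p. 273)] [cite: GreenbergLNM1716, Thm. 1.2 and §1 p. 9] [cite: DokchitserDokchitserAnnals2010, Thm. 1.4] -/
theorem anchor_core :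
    W₀.entireLFunction 1 = 0 ∧ W₀.rootNumber = 1 ∧ Even W₀.analyticRank ∧ 2 ≤ W₀.analyticRank ∧
      W₀.mordellWeilRank = 2 ∧ W₀.selmerCorank 2 = 2 ∧ Finite (AddCommGroup.primaryComponent W₀.sha 2) := by
  obtain ⟨f₀, hf₀⟩ := hmod W₀
  have h17₀ := hKato W₀ f₀ hf₀
  let D₀ : W₀.SelmerDualData κ γ := W₀.selmerDualData κ hγ
  have hX₀ : D₀.IsTorsion := (h17₀ κ γ hκ hγ hγ' hord₀ hf₀ D₀).1
  have h4 : 4 ≤ 2 ^ W₀.mordellWeilRank :=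
    (show (4 : ℕ) = 2 ^ 2 by norm_num).le.trans (Nat.pow_le_pow_right (by norm_num) hrank₀)
  have hμ₀ : D₀.mu = 0 :=
    SelmerDualData.mu_eq_zero_of_natCard_selmerFixedCert_one_le (p := 2) hγ D₀ hX₀ (hcert.trans h4)
  obtain ⟨L₀, hL₀⟩ := exists_integralLift_two hord₀ hf₀
  obtain ⟨-, -, -, -, hrank, hcorank, hfin⟩ :=
    anchor_base_of_chi8Floor W₀ hord₀ hκ hγ hγ' hf₀ h17₀ hL₀ (hS₀ f₀ hf₀) hrank₀ D₀ hμ₀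
  have hL1 : W₀.entireLFunction 1 = 0 := by
    by_contra h
    obtain ⟨-, hc0, -, -⟩ := selmerCorank_eq_zero_of_L_ne_zero W₀ hord₀ hf₀ h17₀ h
    omega
  have hw : W₀.rootNumber = 1 := by
    have h : (-1 : ℤ) ^ W₀.selmerCorank 2 = W₀.rootNumber := hpar W₀
    rw [hcorank] at h; rw [← h]; norm_num
  have hL : W₀.HasEntireLFunction := hasEntireLFunction_rat_of_exists_isNewformOf hmod W₀
  have heven : Even W₀.analyticRank := (even_analyticRank_iff_of_exists_isNewformOf hmod W₀).mpr hw
  have h1 : 1 ≤ W₀.analyticRank := one_le_analyticRank_of_apply_one_eq_zero W₀ hL hL1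
  have h2' : 2 ≤ W₀.analyticRank := by obtain ⟨k, hk⟩ := heven; omega
  exact ⟨hL1, hw, heven, h2', hrank, hcorank, hfin⟩

/-- **THE BSD-RANK DOOR AT THE ANCHOR**: `r_an(E) = rank E(ℚ)` ⟺ `L″(E,1) ≠ 0` ⟺ `r_an(E) ≤ 2` (given `anchor_core`: `L(E,1) = 0`, `r_an` even
`≥ 2`, `rank = 2`; `L″ ≠ 0` caps `r_an ≤ 2`; conversely the leading derivative at `r_an = 2` is `L″(E,1)`).  B1: EQUIVALENCES; BSD not proved.
[cite: Kato2004Asterisque, Thm. 17.4 (p. 273)] [cite: CremonaAlgorithms1997, §2.13 p. 37] -/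
theorem anchor_bsdRank_iff :
    (W₀.analyticRank = W₀.mordellWeilRank ↔ iteratedDeriv 2 W₀.entireLFunction 1 ≠ 0) ∧
    (W₀.analyticRank = W₀.mordellWeilRank ↔ W₀.analyticRank ≤ 2) := by
  have hL : W₀.HasEntireLFunction := hasEntireLFunction_rat_of_exists_isNewformOf hmod W₀
  obtain ⟨-, -, -, h2', hrank, -, -⟩ := anchor_core W₀ hord₀ hmod hKato hpar hrank₀ hS₀ hκ hγ hγ' hcert
  have hlead := iteratedDeriv_analyticRank_ne_zero W₀ hL
  refine ⟨⟨fun heq => ?_, fun hD2 => ?_⟩, ⟨fun heq => by omega, fun hle => by omega⟩⟩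
  · have hr : W₀.analyticRank = 2 := by omega
    rw [hr] at hlead; exact hlead
  · have hup : W₀.analyticRank ≤ 2 := analyticRank_le_of_iteratedDeriv_ne_zero W₀ hL hD2
    omega

/-- **THE BSD-RANK DOOR AT THE ANCHOR, implication form**: the displayed input `h2 : L″(E,1) ≠ 0` gives `ord_{s=1} L(E,s) = rank E(ℚ) = 2`,
`L(E,1) = 0`, `Ш(E)[2^∞]` finite.  B1: BSD not proved (conditional on the displayed hypotheses).
[cite: Kato2004Asterisque, Thm. 17.4 (p. 273)] [cite: CremonaAlgorithms1997, §2.13 Prop. 2.13.1] -/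
theorem anchor_bsdRank_of_secondDeriv (h2 : iteratedDeriv 2 W₀.entireLFunction 1 ≠ 0) :
    W₀.analyticRank = W₀.mordellWeilRank ∧ W₀.analyticRank = 2 ∧ W₀.mordellWeilRank = 2 ∧
      W₀.entireLFunction 1 = 0 ∧ Finite (AddCommGroup.primaryComponent W₀.sha 2) := by
  obtain ⟨hL1, -, -, -, hrank, -, hfin⟩ := anchor_core W₀ hord₀ hmod hKato hpar hrank₀ hS₀ hκ hγ hγ' hcert
  obtain ⟨h1, -⟩ := anchor_bsdRank_iff W₀ hord₀ hmod hKato hpar hrank₀ hS₀ hκ hγ hγ' hcert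
  have heq : W₀.analyticRank = W₀.mordellWeilRank := h1.mpr h2
  exact ⟨heq, heq.trans hrank, hrank, hL1, hfin⟩

end Generic

/-! ### §2. The two anchors -/

section Anchors

/-- **BSD-rank for the anchor `E₀ = [1,-1,0,-675,6912]` (`N₀ = 690561 = 3²·277²`) from the certified input `L″(E₀,1) ≠ 0`**:
`ord_{s=1} L(E₀,s) = rank E₀(ℚ) = 2`, `L(E₀,1) = 0`, `Ш(E₀)[2^∞]` finite (good ordinary at `2` and `2 ≤ rank` are tree theorems via
`anchorData_690561`).  CERTIFICATE for `h2` (displayed, not discharged): `L″(E₀,1) ∈ [29.9761563, 29.9761573]` (kit j337494, Arb, BGZ series).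
Modulo PRINT `hmod hKato hpar` + the anchor's `hS₀ hcert` + `h2`.  B1: one curve; BSD not proved.
[cite: Kato2004Asterisque, Thm. 17.4 (p. 273)] [cite: CremonaAlgorithms1997, §2.13 Prop. 2.13.1] [cite: DokchitserDokchitserAnnals2010, Thm. 1.4] -/
theorem bsdRank_690561_of_secondDeriv (W₀ : WeierstrassCurve ℚ) [W₀.IsElliptic] [W₀.IsGloballyMinimal]
    [NeZero (W₀.conductorNorm ℤ)] (hW₀ : W₀ = ⟨1, -1, 0, -675, 6912⟩)
    (hmod : exists_isNewformOf)
    (hKato : ∀ (V : WeierstrassCurve ℚ) [V.IsElliptic] [V.IsGloballyMinimal] [NeZero (V.conductorNorm ℤ)]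
      (f : CuspForm (Gamma0 (V.conductorNorm ℤ)) 2), IsNewformOf V f → kato_divisibility_allPrimes V 2 (f := f))
    (hpar : ∀ (V : WeierstrassCurve ℚ) [V.IsElliptic], p_parity V 2)
    (hS₀ : ∀ f₀ : CuspForm (Gamma0 (W₀.conductorNorm ℤ)) 2, IsNewformOf W₀ f₀ → (2 : ℝ)⁻¹ ^ 3 <
      ‖((ratTwistedSymbolSum f₀ (ZMod.χ₈.ringHomComp (Int.castRingHom ℚ)) : ℚ) : ℚ_[2])‖)
    {κ : ZpExtension ℚ 2} {γ : Field.absoluteGaloisGroup ℚ} (hκ : κ.IsCyclotomic)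
    (hγ : κ.IsTopGenerator γ) (hγ' : IsCyclotomicVariable 2 γ)
    [Finite (selmerFixedCert W₀ κ γ 1)] (hcert : Nat.card (selmerFixedCert W₀ κ γ 1) ≤ 4)
    (h2 : iteratedDeriv 2 W₀.entireLFunction 1 ≠ 0) :
    W₀.analyticRank = W₀.mordellWeilRank ∧ W₀.analyticRank = 2 ∧ W₀.mordellWeilRank = 2 ∧
      W₀.entireLFunction 1 = 0 ∧ Finite (AddCommGroup.primaryComponent W₀.sha 2) := by
  obtain ⟨hord₀, hrank₀, -, -⟩ := anchorData_690561 W₀ hW₀ (q := 5) (by norm_num) (by decide) (by decide)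
  exact anchor_bsdRank_of_secondDeriv W₀ hord₀ hmod hKato hpar hrank₀ hS₀ hκ hγ hγ' hcert h2

/-- **BSD-rank for the third anchor `E₁ = [1,-1,0,-21016,-1167149]` (`N₁ = 19070689 = 11²·397²`) from the certified input `L″(E₁,1) ≠ 0`**:
`ord_{s=1} L(E₁,s) = rank E₁(ℚ) = 2`, `L(E₁,1) = 0`, `Ш(E₁)[2^∞]` finite (via `anchorData_19070689`).  CERTIFICATE for `h2`:
`L″(E₁,1) ∈ [44.2219458, 44.2219508]` (kit j337494).  Modulo PRINT `hmod hKato hpar` + this anchor's `hS₁ hcert` + `h2`.  B1: one curve;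
BSD not proved. [cite: Kato2004Asterisque, Thm. 17.4 (p. 273)] [cite: CremonaAlgorithms1997, §2.13 Prop. 2.13.1]
[cite: DokchitserDokchitserAnnals2010, Thm. 1.4] -/
theorem bsdRank_19070689_of_secondDeriv (W₁ : WeierstrassCurve ℚ) [W₁.IsElliptic] [W₁.IsGloballyMinimal]
    [NeZero (W₁.conductorNorm ℤ)] (hW₁ : W₁ = ⟨1, -1, 0, -21016, -1167149⟩)
    (hmod : exists_isNewformOf)
    (hKato : ∀ (V : WeierstrassCurve ℚ) [V.IsElliptic] [V.IsGloballyMinimal] [NeZero (V.conductorNorm ℤ)]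
      (f : CuspForm (Gamma0 (V.conductorNorm ℤ)) 2), IsNewformOf V f → kato_divisibility_allPrimes V 2 (f := f))
    (hpar : ∀ (V : WeierstrassCurve ℚ) [V.IsElliptic], p_parity V 2)
    (hS₁ : ∀ f₁ : CuspForm (Gamma0 (W₁.conductorNorm ℤ)) 2, IsNewformOf W₁ f₁ → (2 : ℝ)⁻¹ ^ 3 <
      ‖((ratTwistedSymbolSum f₁ (ZMod.χ₈.ringHomComp (Int.castRingHom ℚ)) : ℚ) : ℚ_[2])‖)
    {κ : ZpExtension ℚ 2} {γ : Field.absoluteGaloisGroup ℚ} (hκ : κ.IsCyclotomic)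
    (hγ : κ.IsTopGenerator γ) (hγ' : IsCyclotomicVariable 2 γ)
    [Finite (selmerFixedCert W₁ κ γ 1)] (hcert : Nat.card (selmerFixedCert W₁ κ γ 1) ≤ 4)
    (h2 : iteratedDeriv 2 W₁.entireLFunction 1 ≠ 0) :
    W₁.analyticRank = W₁.mordellWeilRank ∧ W₁.analyticRank = 2 ∧ W₁.mordellWeilRank = 2 ∧
      W₁.entireLFunction 1 = 0 ∧ Finite (AddCommGroup.primaryComponent W₁.sha 2) := by
  obtain ⟨hord₁, hrank₁, -, -⟩ := anchorData_19070689 W₁ hW₁ (q := 5) (by norm_num) (by decide) (by decide)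
  exact anchor_bsdRank_of_secondDeriv W₁ hord₁ hmod hKato hpar hrank₁ hS₁ hκ hγ hγ' hcert h2

end Anchors

end Summit.BirchSwinnertonDyer.Rank2

end
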